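import Mathlib
import HarnessLib
import Summits.NavierStokesRegularity.NavierStokesRegularity.Theorems.PoloidalWindowDoorLrcModEntireJetCertTree

/-!
# Route `PoloidalWindowDoor`, item `LrcModEntire` (stmt-NavierStokesRegularity-20428) — a FASTER total derivative for the certificate
# checker (support-restricted, zero terms dropped) with its own masked interpreter, tree checker and soundness

Cell ns-regularity-ideate, seat ns-poloidal-K2-p3 gen 7 (lead of item 20428; `--supports stmt-NavierStokesRegularity-20428`; definitions reviewed).
The v1 total derivative `…JetCertDefs.tderiv n S p` concatenates, for EVERY letter `a < n`, the `|p|` terms of `∂p/∂Xₐ · S a` — almost all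
with coefficient `0` when `n` (the jet size, `10³–10⁴` for a truncated (TH) jet) exceeds the few hundred letters occurring in `p`; the
subsequent `normalize` is quadratic in that inflated length.  Here `tderivF` only visits letters in the SUPPORT of `p` and drops zero
terms (`pderivNZ`); the interpreter `tderivWordF / combineF / deriveF / certCheckF / checkTreeF` is the masked one of `…JetCertMasked` /
`…JetCertTree` with `tderivF` inside, and the soundness chain is re-proved verbatim (`fderiv_ev_eq_ev_tderivF_masked`, …,
`not_localDatum_of_checkTreeF`) against the SAME `LocalDatum` — so the (TH) wiring applies unchanged (`…THCert` builds the local datum;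
a fast closing theorem is one line, in the sequel of `…THCert`).

WHAT THIS IS NOT: not a claim about Navier–Stokes — checker performance plumbing (bears_on LADDER-NS N0, item 20428 `stub_localTHEmpty`). [folklore]
-/

noncomputable section

-- the summit and its single sub-problem share the name (CONVENTIONS §1), as in every Theorems file
set_option linter.dupNamespace false

namespace Summit.NavierStokesRegularity.NavierStokesRegularity.Theorems.PoloidalWindowDoorLrcModEntireJetCertFast

open _root_.Topology _root_.Filter Set
open Literature.Analysis.ValidatedNumerics Literature.Analysis.ValidatedNumerics.QMvPoly
open Literature.Analysis.Calculus.MvPoly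
open Summit.NavierStokesRegularity.NavierStokesRegularity.Theorems.PoloidalWindowDoorLrcModEntireJetCertDefs
open Summit.NavierStokesRegularity.NavierStokesRegularity.Theorems.PoloidalWindowDoorLrcModEntireJetCertMasked
open Summit.NavierStokesRegularity.NavierStokesRegularity.Theorems.PoloidalWindowDoorLrcModEntireJetCertTree

variable {E : Type*} [NormedAddCommGroup E] [NormedSpace ℝ E] {n : ℕ}

/-! ### Zero-term filtering and the support -/

/-- Drop the terms with coefficient `0`. [folklore] -/
def dropZero (p : QMvPoly) : QMvPoly := p.filter fun t => t.2 ≠ 0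

/-- Dropping zero terms does not change the polynomial. [folklore] -/
theorem toMv_dropZero (p : QMvPoly) : QMvPoly.toMv ℝ n (dropZero p) = QMvPoly.toMv ℝ n p := by
  induction p with
  | nil => simp [dropZero]
  | cons t p ih =>
    rw [dropZero] at ih ⊢
    by_cases h : t.2 = 0
    · rw [List.filter_cons_of_neg (by simp [h]), ih, QMvPoly.toMv_cons, h]
      simp
    · rw [List.filter_cons_of_pos (by simpa using h), QMvPoly.toMv_cons, QMvPoly.toMv_cons, ih]

/-- `∂/∂Xₐ` with zero terms dropped. [folklore] -/
def pderivNZ (a : ℕ) (p : QMvPoly) : QMvPoly := dropZero (QMvPoly.pderivQ a p)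

/-- The letters occurring (with a positive exponent) in a term list. [folklore] -/
def support (p : QMvPoly) : List ℕ :=
  (p.flatMap fun t => (List.range t.1.length).filter fun i => t.1.getD i 0 ≠ 0).dedup

/-- A letter outside the support has exponent `0` in every term. [folklore] -/
theorem getD_eq_zero_of_not_mem_support {p : QMvPoly} {a : ℕ} (ha : a ∉ support p) :
    ∀ t ∈ p, t.1.getD a 0 = 0 := by
  intro t ht
  by_contra hne
  apply ha
  rw [support, List.mem_dedup, List.mem_flatMap]
  refine ⟨t, ht, ?_⟩
  rw [List.mem_filter, List.mem_range]
  refine ⟨?_, by simpa using hne⟩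
  by_contra hlt
  push Not at hlt
  exact hne (List.getD_eq_default _ _ hlt)

/-- `∂p/∂Xₐ = 0` for a letter outside the support. [folklore] -/
theorem toMv_pderivQ_eq_zero_of_not_mem_support {p : QMvPoly} {a : Fin n} (ha : (a : ℕ) ∉ support p) :
    QMvPoly.toMv ℝ n (QMvPoly.pderivQ a p) = 0 := by
  have h0 := getD_eq_zero_of_not_mem_support ha
  clear ha
  unfold QMvPoly.pderivQ
  induction p with
  | nil => simp
  | cons t p ih =>
    rw [List.map_cons, QMvPoly.toMv_cons, ih (fun t' ht' => h0 t' (List.mem_cons_of_mem _ ht')), h0 t List.mem_cons_self]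
    simp

/-! ### The fast total derivative -/

/-- **FAST TOTAL DERIVATIVE**: only the letters of the support contribute, zero terms dropped. [folklore] -/
def tderivF (n : ℕ) (S : ℕ → QMvPoly) (p : QMvPoly) : QMvPoly :=
  let sp := support p
  ((List.range n).map fun a => if a ∈ sp then QMvPoly.mul (pderivNZ a p) (S a) else []).flatten

/-- The fast total derivative means the same polynomial as the v1 one. [folklore] -/
theorem toMv_tderivF (n : ℕ) (S : ℕ → QMvPoly) (p : QMvPoly) :
    QMvPoly.toMv ℝ n (tderivF n S p) =
      ∑ a : Fin n, MvPolynomial.pderiv a (QMvPoly.toMv ℝ n p) * QMvPoly.toMv ℝ n (S a) := by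
  rw [tderivF, QMvPoly.toMv_flatten, List.map_map, sum_map_range]
  refine Finset.sum_congr rfl fun a _ => ?_
  simp only [Function.comp]
  split_ifs with h
  · rw [QMvPoly.toMv_mul, pderivNZ, toMv_dropZero, QMvPoly.toMv_pderivQ]
  · rw [QMvPoly.toMv_nil, ← QMvPoly.toMv_pderivQ, toMv_pderivQ_eq_zero_of_not_mem_support h, zero_mul]

/-- **Masked chain rule for the fast derivative.** [folklore] -/
theorem fderiv_ev_eq_ev_tderivF_masked {g : E → EuclideanSpace ℝ (Fin n)} {x v : E} {S : ℕ → QMvPoly} {m : ℕ → Bool}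
    (hg : DifferentiableAt ℝ g x) (hS : ∀ i : Fin n, m i = true → fderiv ℝ (fun y => g y i) x v = ev n (S i) (g x))
    {q : QMvPoly} (hq : usesOnlyTabled n m q = true) :
    fderiv ℝ (fun y => ev n q (g y)) x v = ev n (tderivF n S q) (g x) := by
  rw [fderiv_ev_eq_ev_tderiv_masked hg hS hq, ev, ev, toMv_tderiv, toMv_tderivF]

/-! ### Fast masked interpreter and tree checker -/

/-- Iterated fast derivative along a word, mask-checked. [folklore] -/
def tderivWordF (n : ℕ) (S : ℕ → ℕ → QMvPoly) (M : ℕ → ℕ → Bool) : List ℕ → QMvPoly → Option QMvPoly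
  | [], p => some p
  | j :: w, p =>
      match tderivWordF n S M w p with
      | none => none
      | some q => if usesOnlyTabled n (M j) q then some (QMvPoly.normalize (tderivF n (S j) q)) else none

/-- One fast certificate step. [folklore] -/
def combineF (n : ℕ) (S : ℕ → ℕ → QMvPoly) (M : ℕ → ℕ → Bool) (laws : List QMvPoly)
    (step : List (QMvPoly × ℕ × List ℕ)) : Option QMvPoly :=
  match optFlatten (step.map fun s =>
      (tderivWordF n S M s.2.2 (laws.getD s.2.1 [])).map fun q => QMvPoly.mul s.1 q) with
  | none => none
  | some r => some (QMvPoly.normalize r)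

/-- The fast masked interpreter. [folklore] -/
def deriveF (n : ℕ) (S : ℕ → ℕ → QMvPoly) (M : ℕ → ℕ → Bool) :
    List QMvPoly → List (List (QMvPoly × ℕ × List ℕ)) → Option (List QMvPoly)
  | laws, [] => some laws
  | laws, step :: rest =>
      match combineF n S M laws step with
      | none => none
      | some L => deriveF n S M (laws ++ [L]) rest

/-- ONE BOOLEAN for a fast masked certificate. [folklore] -/
def certCheckF (n : ℕ) (S : ℕ → ℕ → QMvPoly) (M : ℕ → ℕ → Bool) (hyps : List QMvPoly)
    (cert : List (List (QMvPoly × ℕ × List ℕ))) (k : ℕ) (T : QMvPoly) : Bool :=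
  match deriveF n S M hyps cert with
  | none => false
  | some laws => decide (QMvPoly.normalize (laws.getD k [] ++ QMvPoly.smul (-1) T) = [])

/-- The fast tree checker. [folklore] -/
def checkTreeF (n : ℕ) (S : ℕ → ℕ → QMvPoly) (M : ℕ → ℕ → Bool) : List QMvPoly → List QMvPoly → CertTree → Bool
  | hyps, pins, .leaf cert k e => certCheckF n S M hyps cert k (pinProduct pins e)
  | hyps, pins, .split π nz z => checkTreeF n S M hyps (pins ++ [π]) nz && checkTreeF n S M (hyps ++ [π]) pins z

/-! ### Soundness (verbatim the masked/tree proofs with the fast derivative) -/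

section Soundness

variable {U : Set E} {g : E → EuclideanSpace ℝ (Fin n)} {v : ℕ → E} {S : ℕ → ℕ → QMvPoly} {M : ℕ → ℕ → Bool}

/-- [folklore] -/
theorem ev_tderivF_eq_zero_masked (hU : IsOpen U) {w : E} {S₁ : ℕ → QMvPoly} {m : ℕ → Bool}
    (hg : ∀ x ∈ U, DifferentiableAt ℝ g x)
    (hS : ∀ i : Fin n, m i = true → ∀ x ∈ U, fderiv ℝ (fun y => g y i) x w = ev n (S₁ i) (g x))
    {L : QMvPoly} (hL : ∀ x ∈ U, ev n L (g x) = 0) (hq : usesOnlyTabled n m L = true) :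
    ∀ x ∈ U, ev n (tderivF n S₁ L) (g x) = 0 := by
  intro x hx
  rw [← fderiv_ev_eq_ev_tderivF_masked (hg x hx) (fun i hi => hS i hi x hx) hq]
  have hev : (fun y => ev n L (g y)) =ᶠ[𝓝 x] fun _ => (0 : ℝ) := by
    filter_upwards [hU.mem_nhds hx] with y hy using hL y hy
  rw [hev.fderiv_eq]
  simp

/-- [folklore] -/
theorem ev_tderivWordF_eq_zero (hU : IsOpen U) (hg : ∀ x ∈ U, DifferentiableAt ℝ g x)
    (hS : ∀ j, ∀ i : Fin n, M j i = true → ∀ x ∈ U, fderiv ℝ (fun y => g y i) x (v j) = ev n (S j i) (g x))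
    {L : QMvPoly} (hL : ∀ x ∈ U, ev n L (g x) = 0) :
    ∀ (w : List ℕ) (q : QMvPoly), tderivWordF n S M w L = some q → ∀ x ∈ U, ev n q (g x) = 0 := by
  intro w
  induction w with
  | nil =>
    intro q hq
    simp only [tderivWordF, Option.some.injEq] at hq
    subst hq
    exact hL
  | cons j w ih =>
    intro q hq x hx
    simp only [tderivWordF] at hq
    cases hrec : tderivWordF n S M w L with
    | none => simp [hrec] at hq
    | some r =>
      simp only [hrec] at hq
      by_cases hmask : usesOnlyTabled n (M j) r = true
      · simp only [hmask, ↓reduceIte, Option.some.injEq] at hq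
        subst hq
        rw [ev_normalize]
        exact ev_tderivF_eq_zero_masked hU hg (hS j) (ih r hrec) hmask x hx
      · simp [hmask] at hq

/-- [folklore] -/
theorem ev_combineF_eq_zero (hU : IsOpen U) (hg : ∀ x ∈ U, DifferentiableAt ℝ g x)
    (hS : ∀ j, ∀ i : Fin n, M j i = true → ∀ x ∈ U, fderiv ℝ (fun y => g y i) x (v j) = ev n (S j i) (g x))
    {laws : List QMvPoly} (hlaws : ∀ L ∈ laws, ∀ x ∈ U, ev n L (g x) = 0) (step : List (QMvPoly × ℕ × List ℕ))
    {r : QMvPoly} (hr : combineF n S M laws step = some r) : ∀ x ∈ U, ev n r (g x) = 0 := by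
  intro x hx
  unfold combineF at hr
  split at hr
  · exact absurd hr (by simp)
  · rename_i r' hflat
    simp only [Option.some.injEq] at hr
    subst hr
    rw [ev_normalize]
    refine ev_optFlatten_eq_zero _ r' hflat fun q hq => ?_
    obtain ⟨s, -, hs⟩ := List.mem_map.1 hq
    obtain ⟨q', hw, rfl⟩ := Option.map_eq_some_iff.1 hs
    have hsrc : ∀ y ∈ U, ev n (laws.getD s.2.1 []) (g y) = 0 := by
      intro y hy
      rw [List.getD_eq_getElem?_getD]
      cases h : laws[s.2.1]? with
      | none => simp
      | some L => simpa using hlaws L (List.mem_of_getElem? h) y hy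
    rw [ev_mul, ev_tderivWordF_eq_zero hU hg hS hsrc s.2.2 q' hw x hx, mul_zero]

/-- [folklore] -/
theorem ev_deriveF_eq_zero (hU : IsOpen U) (hg : ∀ x ∈ U, DifferentiableAt ℝ g x)
    (hS : ∀ j, ∀ i : Fin n, M j i = true → ∀ x ∈ U, fderiv ℝ (fun y => g y i) x (v j) = ev n (S j i) (g x))
    (cert : List (List (QMvPoly × ℕ × List ℕ))) :
    ∀ (laws : List QMvPoly), (∀ L ∈ laws, ∀ x ∈ U, ev n L (g x) = 0) →
      ∀ laws', deriveF n S M laws cert = some laws' → ∀ L ∈ laws', ∀ x ∈ U, ev n L (g x) = 0 := by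
  induction cert with
  | nil =>
    intro laws hlaws laws' h
    simp only [deriveF, Option.some.injEq] at h
    subst h
    exact hlaws
  | cons step rest ih =>
    intro laws hlaws laws' h
    simp only [deriveF] at h
    cases hc : combineF n S M laws step with
    | none => simp [hc] at h
    | some L =>
      simp only [hc] at h
      refine ih _ (fun L' hL' => ?_) laws' h
      rcases List.mem_append.1 hL' with h' | h'
      · exact hlaws L' h'
      · rw [List.mem_singleton.1 h']
        exact ev_combineF_eq_zero hU hg hS hlaws step hc

/-- **CONTRADICTION FROM A FAST MASKED CERTIFICATE.** [folklore] -/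
theorem cert_contradictionF (hU : IsOpen U) (hg : ∀ x ∈ U, DifferentiableAt ℝ g x)
    (hS : ∀ j, ∀ i : Fin n, M j i = true → ∀ x ∈ U, fderiv ℝ (fun y => g y i) x (v j) = ev n (S j i) (g x))
    {hyps : List QMvPoly} (hhyps : ∀ L ∈ hyps, ∀ x ∈ U, ev n L (g x) = 0)
    {cert : List (List (QMvPoly × ℕ × List ℕ))} {k : ℕ} {T : QMvPoly}
    (hcheck : certCheckF n S M hyps cert k T = true) {x₀ : E} (hx₀ : x₀ ∈ U) (hT : ev n T (g x₀) ≠ 0) : False := by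
  apply hT
  simp only [certCheckF] at hcheck
  cases hd : deriveF n S M hyps cert with
  | none => simp [hd] at hcheck
  | some laws =>
    simp only [hd, decide_eq_true_eq] at hcheck
    have hlaw : ev n (laws.getD k []) (g x₀) = 0 := by
      rw [List.getD_eq_getElem?_getD]
      cases h : laws[k]? with
      | none => simp
      | some L => simpa using ev_deriveF_eq_zero hU hg hS cert hyps hhyps laws hd L (List.mem_of_getElem? h) x₀ hx₀
    have hdiff : ev n (laws.getD k [] ++ QMvPoly.smul (-1) T) (g x₀) = 0 := by
      rw [← ev_normalize, hcheck, ev_nil]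
    rw [ev_append, ev_smul, hlaw] at hdiff
    simpa using hdiff

end Soundness

/-- **SOUNDNESS OF FAST CERTIFICATE TREES** (verbatim `not_localDatum_of_checkTree` with `checkTreeF`). [folklore] -/
theorem not_localDatum_of_checkTreeF {S : ℕ → ℕ → QMvPoly} {M : ℕ → ℕ → Bool} {v : ℕ → E} :
    ∀ (t : CertTree) (hyps pins : List QMvPoly), checkTreeF n S M hyps pins t = true → ¬ LocalDatum n S M v hyps pins := by
  intro t
  induction t with
  | leaf cert k e =>
    intro hyps pins hcheck hdat
    obtain ⟨U, p₀, g, hU, hp₀, hg, hS, hhyps, hpins⟩ := hdat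
    simp only [checkTreeF] at hcheck
    exact cert_contradictionF hU hg hS hhyps hcheck hp₀ (ev_pinProduct_ne_zero (g p₀) pins e hpins)
  | split π nz z ihnz ihz =>
    intro hyps pins hcheck hdat
    simp only [checkTreeF, Bool.and_eq_true] at hcheck
    obtain ⟨hc1, hc2⟩ := hcheck
    obtain ⟨U, p₀, g, hU, hp₀, hg, hS, hhyps, hpins⟩ := hdat
    by_cases hzero : ∃ V : Set E, IsOpen V ∧ p₀ ∈ V ∧ ∀ x ∈ V, ev n π (g x) = 0
    · obtain ⟨V, hV, hp₀V, hπ⟩ := hzero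
      refine ihz (hyps ++ [π]) pins hc2 ⟨U ∩ V, p₀, g, hU.inter hV, ⟨hp₀, hp₀V⟩, fun x hx => hg x hx.1,
        fun j i hi x hx => hS j i hi x hx.1, ?_, hpins⟩
      intro L hL x hx
      rcases List.mem_append.1 hL with h | h
      · exact hhyps L h x hx.1
      · rw [List.mem_singleton.1 h]; exact hπ x hx.2
    · push Not at hzero
      set N : Set E := U ∩ ⋂ π' ∈ pins, {x | ev n π' (g x) ≠ 0} with hN
      have hNnhds : N ∈ 𝓝 p₀ := by
        refine Filter.inter_mem (hU.mem_nhds hp₀) ?_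
        refine (Filter.biInter_mem (List.finite_toSet pins)).2 fun π' hπ' => ?_
        exact (continuousAt_ev_comp (hg p₀ hp₀) π').eventually_ne (hpins π' hπ')
      obtain ⟨V, hVN, hVo, hp₀V⟩ := mem_nhds_iff.1 hNnhds
      obtain ⟨p₁, hp₁V, hp₁⟩ := hzero V hVo hp₀V
      have hp₁N : p₁ ∈ N := hVN hp₁V
      refine ihnz hyps (pins ++ [π]) hc1 ⟨U, p₁, g, hU, hp₁N.1, hg, hS, hhyps, ?_⟩
      intro π' hπ'
      rcases List.mem_append.1 hπ' with h | h
      · exact (Set.mem_iInter₂.1 hp₁N.2) π' h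
      · rw [List.mem_singleton.1 h]; exact hp₁

/-- Self-test: the tree example of `…JetCertTree` checks with the fast checker too (`decide +kernel`). [folklore] -/
theorem example_checkTreeF :
    checkTreeF 3 exampleTableM exampleMaskM
      [QMvPoly.mul (QMvPoly.var 3 0) (QMvPoly.var 3 1), QMvPoly.var 3 2 ++ QMvPoly.smul (-1) (QMvPoly.var 3 0)]
      [QMvPoly.var 3 0]
      (.split (QMvPoly.var 3 1)
        (.leaf [[(QMvPoly.const 1, 0, [])]] 2 [1, 1])
        (.leaf [[(QMvPoly.const 1, 2, [0])], [(QMvPoly.const (-1), 1, []), (QMvPoly.const 1, 3, [])]] 4 [1])) = true := by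
  decide +kernel

end Summit.NavierStokesRegularity.NavierStokesRegularity.Theorems.PoloidalWindowDoorLrcModEntireJetCertFast

end
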